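import Mathlib
import HarnessLib

/-!
# K3 engine child (stmt-HubbardSuperconductivity-19855), stub `stub_engine_scale0`, clause (E1-v4)₀: the per-order algebra of the
# bi-graded scale-`0` bound (`κ₀` and `β/M` cancel; `p - 1` powers of `|U|`)

Cell gate-hubbard-kl, seat hubbard-kl-k3c2-p1.  Second lemma of the final numeric assembly (after `scaleZero_T_le`): with
`T ≤ C_T·M/β`, `f₂ = (e²·2κ₀)⁴·|U|β/(4M)`, `α = 4M·A₀/β` and `θ ≤ 1/2`, the right-hand side of
`klAnisoLegKernelNorm_zero_le_explicit`,
`T·(2T)^{2p-1}·(β/(2M))^{2p-1}·(κ₀^{-2p}·e f₂·(eαf₂/κ₀²)^{p-2}/(1-θ)^p)`, is at most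
`2^p · 4e⁹κ₀⁴ · (C_T²/κ₀²)^p · (16e⁹κ₀²A₀|U|)^{p-2} · |U|` — `p - 1` powers of `|U|`, no `β`, `L`, `M` left (pure real algebra).

* **`scaleZero_order_algebra_le`**.

Everything is proved; no definitions, no named facts, no sorry.
-/

noncomputable section

namespace Summit.HubbardSuperconductivity.HubbardSuperconductivity.Theorems.EngineV8

set_option linter.dupNamespace false -- summit = problem name (single-conjunct summit), D-0017

/-- **The per-order algebra**: for `p ≥ 2`, `0 < β`, `0 < M`, `0 < κ₀`, `0 ≤ T ≤ C_T·M/β`, `0 ≤ A₀`, `θ ≤ 1/2`,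
`T(2T)^{2p-1}(β/(2M))^{2p-1}·(κ₀^{-2p}·(e·f₂)·(e·(4MA₀/β)·f₂/κ₀²)^{p-2}/(1-θ)^p) ≤ 2^p·4e⁹κ₀⁴·(C_T²/κ₀²)^p·(16e⁹κ₀²A₀|U|)^{p-2}·|U|`
with `f₂ = (e²(κ₀+κ₀))⁴·(|U|·β/(4M))`. -/
theorem scaleZero_order_algebra_le {β M κ₀ T CT A₀ U θ : ℝ} {p : ℕ} (hp : 2 ≤ p) (hβ : 0 < β) (hM : 0 < M) (hκ₀ : 0 < κ₀)
    (hT0 : 0 ≤ T) (hT : T ≤ CT * M / β) (hA₀ : 0 ≤ A₀) (hθ : θ ≤ 1 / 2) :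
    T * (2 * T) ^ (2 * p - 1) * (β / (2 * M)) ^ (2 * p - 1) *
        (κ₀⁻¹ ^ (2 * p) * (Real.exp 1 * ((Real.exp 2 * (κ₀ + κ₀)) ^ (2 * 2) * (|U| * β / (4 * M)))) *
          (Real.exp 1 * (4 * M * A₀ / β) * ((Real.exp 2 * (κ₀ + κ₀)) ^ (2 * 2) * (|U| * β / (4 * M))) / κ₀ ^ 2) ^ (p - 2) /
            (1 - θ) ^ p) ≤
      2 ^ p * (4 * Real.exp 1 ^ 9 * κ₀ ^ 4) * (CT ^ 2 / κ₀ ^ 2) ^ p * (16 * Real.exp 1 ^ 9 * κ₀ ^ 2 * A₀ * |U|) ^ (p - 2) * |U| := by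
  obtain ⟨q, rfl⟩ : ∃ q, p = q + 2 := ⟨p - 2, by omega⟩
  rw [show 2 * (q + 2) - 1 = 2 * q + 3 by omega, show q + 2 - 2 = q by omega]
  have hCT : 0 ≤ CT := by
    have h1 : T * β ≤ CT * M := (le_div_iff₀ hβ).1 hT
    have h2 : 0 ≤ T * β := mul_nonneg hT0 hβ.le
    by_contra hneg
    push Not at hneg
    nlinarith [mul_neg_of_neg_of_pos hneg hM]
  have h1θ : 0 < 1 - θ := by linarith
  have he : 0 < Real.exp 1 := Real.exp_pos 1
  have he2 : Real.exp 2 = Real.exp 1 ^ 2 := by rw [← Real.exp_nat_mul]; norm_num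
  have hU : 0 ≤ |U| := abs_nonneg U
  -- (1) the `T`-chain: `T (2T)^{2p-1} (β/(2M))^{2p-1} = T (Tβ/M)^{2p-1} ≤ C_T^{2p} M/β`
  have hTβM : T * β / M ≤ CT := by
    rw [div_le_iff₀ hM]
    have := (le_div_iff₀ hβ).1 hT
    nlinarith
  have hTβM0 : 0 ≤ T * β / M := by positivity
  have h1 : T * (2 * T) ^ (2 * q + 3) * (β / (2 * M)) ^ (2 * q + 3) ≤ CT ^ (2 * (q + 2)) * (M / β) := by
    have heq : T * (2 * T) ^ (2 * q + 3) * (β / (2 * M)) ^ (2 * q + 3) = T * (T * β / M) ^ (2 * q + 3) := by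
      rw [mul_assoc, ← mul_pow]
      congr 2
      field_simp
    rw [heq]
    have hpow : (T * β / M) ^ (2 * q + 3) ≤ CT ^ (2 * q + 3) := pow_le_pow_left₀ hTβM0 hTβM _
    have hT' : T ≤ CT * (M / β) := by rwa [← mul_div_assoc]
    calc T * (T * β / M) ^ (2 * q + 3) ≤ (CT * (M / β)) * CT ^ (2 * q + 3) :=
          mul_le_mul hT' hpow (by positivity) (by positivity)
      _ = CT ^ (2 * (q + 2)) * (M / β) := by
          rw [show 2 * (q + 2) = (2 * q + 3) + 1 by ring, pow_succ]
          ring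
  -- (2) the geometric denominator
  have h2 : 1 / (1 - θ) ^ (q + 2) ≤ 2 ^ (q + 2) := by
    rw [div_le_iff₀ (pow_pos (by linarith) _), ← mul_pow]
    have : 1 ≤ 2 * (1 - θ) := by linarith
    exact one_le_pow₀ this
  -- (3) the vertex factors in closed form
  have hf : Real.exp 1 * ((Real.exp 2 * (κ₀ + κ₀)) ^ (2 * 2) * (|U| * β / (4 * M))) =
      4 * Real.exp 1 ^ 9 * κ₀ ^ 4 * |U| * (β / M) := by
    rw [he2]; field_simp; ring
  have hg : Real.exp 1 * (4 * M * A₀ / β) * ((Real.exp 2 * (κ₀ + κ₀)) ^ (2 * 2) * (|U| * β / (4 * M))) / κ₀ ^ 2 =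
      16 * Real.exp 1 ^ 9 * κ₀ ^ 2 * A₀ * |U| := by
    rw [he2]; field_simp; ring
  rw [hf, hg]
  -- (4) assemble
  have hK : κ₀⁻¹ ^ (2 * (q + 2)) = (κ₀ ^ 2)⁻¹ ^ (q + 2) := by rw [← inv_pow, ← pow_mul]
  rw [hK]
  have hrest0 : 0 ≤ (κ₀ ^ 2)⁻¹ ^ (q + 2) * (4 * Real.exp 1 ^ 9 * κ₀ ^ 4 * |U| * (β / M)) *
      (16 * Real.exp 1 ^ 9 * κ₀ ^ 2 * A₀ * |U|) ^ q := by positivity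
  calc T * (2 * T) ^ (2 * q + 3) * (β / (2 * M)) ^ (2 * q + 3) *
        ((κ₀ ^ 2)⁻¹ ^ (q + 2) * (4 * Real.exp 1 ^ 9 * κ₀ ^ 4 * |U| * (β / M)) *
          (16 * Real.exp 1 ^ 9 * κ₀ ^ 2 * A₀ * |U|) ^ q / (1 - θ) ^ (q + 2))
      = (T * (2 * T) ^ (2 * q + 3) * (β / (2 * M)) ^ (2 * q + 3)) *
          (((κ₀ ^ 2)⁻¹ ^ (q + 2) * (4 * Real.exp 1 ^ 9 * κ₀ ^ 4 * |U| * (β / M)) *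
            (16 * Real.exp 1 ^ 9 * κ₀ ^ 2 * A₀ * |U|) ^ q) * (1 / (1 - θ) ^ (q + 2))) := by ring
    _ ≤ (CT ^ (2 * (q + 2)) * (M / β)) *
          (((κ₀ ^ 2)⁻¹ ^ (q + 2) * (4 * Real.exp 1 ^ 9 * κ₀ ^ 4 * |U| * (β / M)) *
            (16 * Real.exp 1 ^ 9 * κ₀ ^ 2 * A₀ * |U|) ^ q) * 2 ^ (q + 2)) :=
        mul_le_mul h1 (mul_le_mul_of_nonneg_left h2 hrest0) (mul_nonneg hrest0 (by positivity)) (by positivity)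
    _ = 2 ^ (q + 2) * (4 * Real.exp 1 ^ 9 * κ₀ ^ 4) * (CT ^ 2 / κ₀ ^ 2) ^ (q + 2) *
          (16 * Real.exp 1 ^ 9 * κ₀ ^ 2 * A₀ * |U|) ^ q * |U| := by
        rw [div_pow, pow_mul, inv_pow]
        field_simp

end Summit.HubbardSuperconductivity.HubbardSuperconductivity.Theorems.EngineV8

end
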